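import Literature.AlgebraicGeometry.Deformation.PairLiftTwistedCocycleReduction
import HarnessLib

/-!
# The closed-fibre dictionary of lifted transition units: exactness descends along `θ ⊗ 1`, and over `k` an exact twisted
# cocycle is an honest Čech cocycle of units (Hartshorne, *Deformation Theory*, Thm. 6.4 (a) proof: «`𝓛' ⊗ 𝒪_X = 𝓛`»)

Layer `Literature/AlgebraicGeometry/Deformation` (cell `hodgecm-mathlib`, F-11 sub-line `F11SmoothRoadA`, α1 grandchild
`F11LiftWithLineBundle`, stub G2, junction (iii) sequel; THEOREMS ONLY — no definition, no instance, no notation, no named fact).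
Sequel of ★ `Deformation/PairLiftTwistedCocycleReduction` (same `variable`s: the currency of ★ `PairLiftTwistedCocycleObstruction`
plus a surjective `k`-algebra map `θ : A' → A''`).

* §1 **`twistedCocycle_map_of_twistedCocycle`** — FORWARD DESCENT: if the units `G j l` over `A'` satisfy the EXACT twisted cocycle
  identity w.r.t. `ψ` (`ψ ≡ 1` modulo a nilpotent ideal), then `(θ ⊗ 1) (G j l)` satisfy it w.r.t. the compatible data `φ` over `A''`
  (`map_baseChangeMap`, `map_restrict_symm`).
* §2 over the residue field (`A'' = k`, `φ = 1`): `lid_baseChangeMap` — `lid (Φ y) = (lid y)|` (restriction is `k`-linear for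
  the structures fixed by `halg`); **`cocycle_lid_of_twistedCocycle_one`** — an exact twisted cocycle w.r.t. the TRIVIAL gluing data is,
  through `k ⊗_k Γ(W) ≅ Γ(W)` (`Algebra.TensorProduct.lid`), an honest Čech `1`-cocycle of units `g_{jl}| · g_{lm}| = g_{jm}|` — the
  hypothesis `hgcoc` of ★ `PairLiftTwistedCocycleObstruction.exact_correctedUnits_of_pairObstructionCochain_eq`.
* §3 `sub_one_tmul_lid_mem` — `G - 1 ⊗ lid ((π ⊗ 1) G) ∈ (ker π)·(A' ⊗ Γ)` for an augmentation `π : A' → k` (the hypothesis `hG`);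
  `isUnit_lid_map` — units reduce to units (the hypothesis `hg`).

Consumer (G2 integrator): with `π₀ : A⧸J → k` the residue of the coefficient field and `G⁰` the exact twisted cocycle of
`…GlueLineBundleConverse.exists_twistedCocycle_of_frames` over `A⧸J`, §1 + §2 give the closed-fibre cocycle `g`, §3 the relations
`hG`, `hg` for any lift `G` of `G⁰` (`π = π₀ ∘ mk J`).  HC_CM is proved only modulo the 7 printed citations until rung 0 closes — nothing
here bears on a summit statement.

## References
* [Hartshorne2010] R. Hartshorne, *Deformation Theory*, GTM 257 (2010): Thm. 6.4 (a) and proof (pp. 50–51), Thm. 10.2 (a) proof (p. 81).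
* [AtiyahMacdonald1969] M. F. Atiyah, I. G. Macdonald, *Introduction to Commutative Algebra* (1969): Prop. 2.18 / Ex. 2.2.
-/

noncomputable section

-- `TopCat.Presheaf`/`TopCat.Sheaf` are not reducible (as in Mathlib's `AlgebraicGeometry/Modules`).
set_option backward.isDefEq.respectTransparency false

open CategoryTheory AlgebraicGeometry Opposite TopologicalSpace
open scoped TensorProduct

universe u

namespace Literature.AlgebraicGeometry.Deformation

open Literature.AlgebraicGeometry.Motives

variable {k : Type u} [Field k] {X : Over (Spec (CommRingCat.of k))}
  [instΓ : ∀ W : X.left.Opens, Algebra k Γ(X.left, W)]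
  (halg : ∀ (W : X.left.Opens) (s : k), algebraMap k Γ(X.left, W) s = (constToPresheaf X).app (op W) s)
  {A' A'' : Type u} [CommRing A'] [Algebra k A'] [CommRing A''] [Algebra k A''] (θ : A' →ₐ[k] A'')
  {ι : Type u} (U : ι → X.left.affineOpens) (b : (j l : ι) → Γ(X.left, (U j).1))
  (hb : ∀ j l, (U j).1 ⊓ (U l).1 = X.left.basicOpen (b j l))

/-! ## §1 Exactness descends along `θ ⊗ 1` -/

include halg hb in
/-- **FORWARD DESCENT of the exact twisted cocycle identity**: if the `G j l` over `A'` satisfy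
`Φjm (G j m) = Φjl (G j l) · τjl (Φlm (G l m))` for all characterised `Φ`, `τjl` (w.r.t. `ψ ≡ 1 (mod 𝔫)`, `𝔫` nilpotent), then the
reductions `(θ ⊗ 1) (G j l)` satisfy it w.r.t. any data `φ` over `A''` compatible with `ψ` under `θ ⊗ 1`.
[cite: Hartshorne2010, Thm. 6.4 (a) (proof, pp. 50–51)] [cite: AtiyahMacdonald1969, Prop. 2.18 and Ex. 2.2] -/
theorem twistedCocycle_map_of_twistedCocycle
    (ψ : (j l : ι) → A' ⊗[k] Γ(X.left, (U j).1 ⊓ (U l).1) ≃ₐ[A'] A' ⊗[k] Γ(X.left, (U j).1 ⊓ (U l).1))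
    (𝔫 : Ideal A') (h𝔫 : IsNilpotent 𝔫)
    (hψ : ∀ j l x, ψ j l x - x ∈ 𝔫 • (⊤ : Submodule A' (A' ⊗[k] Γ(X.left, (U j).1 ⊓ (U l).1))))
    (φ : (j l : ι) → A'' ⊗[k] Γ(X.left, (U j).1 ⊓ (U l).1) ≃ₐ[A''] A'' ⊗[k] Γ(X.left, (U j).1 ⊓ (U l).1))
    (hψσ : ∀ j l x, Algebra.TensorProduct.map θ (AlgHom.id k Γ(X.left, (U j).1 ⊓ (U l).1)) (ψ j l x) =
      φ j l (Algebra.TensorProduct.map θ (AlgHom.id k Γ(X.left, (U j).1 ⊓ (U l).1)) x))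
    (G : (j l : ι) → A' ⊗[k] Γ(X.left, (U j).1 ⊓ (U l).1))
    (hGcoc : ∀ (j l m : ι)
      (Φjl : A' ⊗[k] Γ(X.left, (U j).1 ⊓ (U l).1) →ₐ[A'] A' ⊗[k] Γ(X.left, (U j).1 ⊓ (U l).1 ⊓ (U m).1))
      (_ : ∀ a s, Φjl (a ⊗ₜ s) = a ⊗ₜ X.left.presheaf.map (homOfLE inf_le_left).op s)
      (Φlm : A' ⊗[k] Γ(X.left, (U l).1 ⊓ (U m).1) →ₐ[A'] A' ⊗[k] Γ(X.left, (U j).1 ⊓ (U l).1 ⊓ (U m).1))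
      (_ : ∀ a s, Φlm (a ⊗ₜ s) = a ⊗ₜ X.left.presheaf.map
        (homOfLE (le_inf (inf_le_left.trans inf_le_right) inf_le_right)).op s)
      (Φjm : A' ⊗[k] Γ(X.left, (U j).1 ⊓ (U m).1) →ₐ[A'] A' ⊗[k] Γ(X.left, (U j).1 ⊓ (U l).1 ⊓ (U m).1))
      (_ : ∀ a s, Φjm (a ⊗ₜ s) = a ⊗ₜ X.left.presheaf.map
        (homOfLE (le_inf (inf_le_left.trans inf_le_left) inf_le_right)).op s)
      (τjl : A' ⊗[k] Γ(X.left, (U j).1 ⊓ (U l).1 ⊓ (U m).1) ≃ₐ[A'] A' ⊗[k] Γ(X.left, (U j).1 ⊓ (U l).1 ⊓ (U m).1)),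
      (∀ x, τjl (Φjl (ψ j l x)) = Φjl x) → Φjm (G j m) = Φjl (G j l) * τjl (Φlm (G l m))) :
    ∀ (j l m : ι)
      (Φjl : A'' ⊗[k] Γ(X.left, (U j).1 ⊓ (U l).1) →ₐ[A''] A'' ⊗[k] Γ(X.left, (U j).1 ⊓ (U l).1 ⊓ (U m).1))
      (_ : ∀ a s, Φjl (a ⊗ₜ s) = a ⊗ₜ X.left.presheaf.map (homOfLE inf_le_left).op s)
      (Φlm : A'' ⊗[k] Γ(X.left, (U l).1 ⊓ (U m).1) →ₐ[A''] A'' ⊗[k] Γ(X.left, (U j).1 ⊓ (U l).1 ⊓ (U m).1))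
      (_ : ∀ a s, Φlm (a ⊗ₜ s) = a ⊗ₜ X.left.presheaf.map
        (homOfLE (le_inf (inf_le_left.trans inf_le_right) inf_le_right)).op s)
      (Φjm : A'' ⊗[k] Γ(X.left, (U j).1 ⊓ (U m).1) →ₐ[A''] A'' ⊗[k] Γ(X.left, (U j).1 ⊓ (U l).1 ⊓ (U m).1))
      (_ : ∀ a s, Φjm (a ⊗ₜ s) = a ⊗ₜ X.left.presheaf.map
        (homOfLE (le_inf (inf_le_left.trans inf_le_left) inf_le_right)).op s)
      (τjl : A'' ⊗[k] Γ(X.left, (U j).1 ⊓ (U l).1 ⊓ (U m).1) ≃ₐ[A'']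
        A'' ⊗[k] Γ(X.left, (U j).1 ⊓ (U l).1 ⊓ (U m).1)),
      (∀ y, τjl (Φjl (φ j l y)) = Φjl y) →
      Φjm (Algebra.TensorProduct.map θ (AlgHom.id k _) (G j m)) =
        Φjl (Algebra.TensorProduct.map θ (AlgHom.id k _) (G j l)) *
          τjl (Φlm (Algebra.TensorProduct.map θ (AlgHom.id k _) (G l m))) := by
  intro j l m Φjl₀ hΦjl₀ Φlm₀ hΦlm₀ Φjm₀ hΦjm₀ τ₀ hτ₀
  have hle : (U j).1 ⊓ (U l).1 ⊓ (U m).1 ≤ (U j).1 ⊓ (U l).1 := inf_le_left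
  -- base changes and the restriction of `(ψ j l)⁻¹` over `A'`
  obtain ⟨Φjl, hΦjl⟩ := exists_baseChangeMap (A' := A') halg ((U j).1 ⊓ (U l).1) ((U j).1 ⊓ (U l).1 ⊓ (U m).1) hle
  obtain ⟨Φlm, hΦlm⟩ := exists_baseChangeMap (A' := A') halg ((U l).1 ⊓ (U m).1) ((U j).1 ⊓ (U l).1 ⊓ (U m).1)
    (le_inf (inf_le_left.trans inf_le_right) inf_le_right)
  obtain ⟨Φjm, hΦjm⟩ := exists_baseChangeMap (A' := A') halg ((U j).1 ⊓ (U m).1) ((U j).1 ⊓ (U l).1 ⊓ (U m).1)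
    (le_inf (inf_le_left.trans inf_le_left) inf_le_right)
  obtain ⟨τ, hτ, -⟩ := exists_algEquiv_restrict_symm halg 𝔫 (isAffineOpen_inf₂ U b hb j l)
    (X.left.presheaf.map (homOfLE (inf_le_left : (U j).1 ⊓ (U l).1 ≤ (U j).1)).op (b j m))
    (inf_eq_basicOpen_map U b hb inf_le_left m) hle h𝔫 (ψ j l) (hψ j l) (Φ := Φjl) hΦjl
  -- the exact identity upstairs, pushed down by `θ ⊗ 1`
  have h := congrArg (Algebra.TensorProduct.map θ (AlgHom.id k Γ(X.left, (U j).1 ⊓ (U l).1 ⊓ (U m).1)))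
    (hGcoc j l m Φjl hΦjl Φlm hΦlm Φjm hΦjm τ hτ)
  rw [map_mul, map_baseChangeMap θ _ hΦjm hΦjm₀, map_baseChangeMap θ _ hΦjl hΦjl₀,
    map_restrict_symm halg θ U b hb j l m (ψ j l) (φ j l) (hψσ j l) hΦjl hΦjl₀ hτ hτ₀,
    map_baseChangeMap θ _ hΦlm hΦlm₀] at h
  exact h

/-! ## §2 Over the residue field: the trivial gluing data, and the dictionary `k ⊗_k Γ(W) = Γ(W)` -/

include halg in
/-- Restriction is `k`-linear for the structures fixed by `halg`: `lid (Φ y) = (lid y)|_W` for the base change `Φ` over `k`.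
[cite: Hartshorne2010, Thm. 10.2 (proof), p. 81] -/
theorem lid_baseChangeMap {V W : X.left.Opens} (h : W ≤ V)
    {Φ : k ⊗[k] Γ(X.left, V) →ₐ[k] k ⊗[k] Γ(X.left, W)}
    (hΦ : ∀ a s, Φ (a ⊗ₜ s) = a ⊗ₜ X.left.presheaf.map (homOfLE h).op s) (y : k ⊗[k] Γ(X.left, V)) :
    Algebra.TensorProduct.lid k Γ(X.left, W) (Φ y) =
      X.left.presheaf.map (homOfLE h).op (Algebra.TensorProduct.lid k Γ(X.left, V) y) := by
  induction y using TensorProduct.induction_on with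
  | zero => rw [map_zero, map_zero, map_zero, map_zero]
  | tmul a s =>
    rw [hΦ, Algebra.TensorProduct.lid_tmul, Algebra.TensorProduct.lid_tmul, Algebra.smul_def, Algebra.smul_def, map_mul,
      halg, halg, ← CommRingCat.comp_apply, ← (constToPresheaf X).naturality (homOfLE h).op]
    rfl
  | add x y hx hy => rw [map_add, map_add, hx, hy, map_add, map_add]

include halg hb in
/-- **Over `k` with the TRIVIAL gluing data, an exact twisted cocycle is an honest Čech `1`-cocycle of `Γ(W)`**: for
`g j l ∈ k ⊗_k Γ(U j ∩ U l)` with `Φjm (g j m) = Φjl (g j l) · τjl (Φlm (g l m))` for all characterised `Φ` and all `τjl` with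
`τjl (Φjl x) = Φjl x`, the sections `lid (g j l) ∈ Γ(U j ∩ U l)` satisfy `g_{jl}| · g_{lm}| = g_{jm}|` — the hypothesis `hgcoc` of ★
`PairLiftTwistedCocycleObstruction.exact_correctedUnits_of_pairObstructionCochain_eq` (take `τjl := 1`).
[cite: Hartshorne2010, Thm. 6.4 (a) (proof, pp. 50–51)] -/
theorem cocycle_lid_of_twistedCocycle_one (g : (j l : ι) → k ⊗[k] Γ(X.left, (U j).1 ⊓ (U l).1))
    (hgcoc : ∀ (j l m : ι)
      (Φjl : k ⊗[k] Γ(X.left, (U j).1 ⊓ (U l).1) →ₐ[k] k ⊗[k] Γ(X.left, (U j).1 ⊓ (U l).1 ⊓ (U m).1))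
      (_ : ∀ a s, Φjl (a ⊗ₜ s) = a ⊗ₜ X.left.presheaf.map (homOfLE inf_le_left).op s)
      (Φlm : k ⊗[k] Γ(X.left, (U l).1 ⊓ (U m).1) →ₐ[k] k ⊗[k] Γ(X.left, (U j).1 ⊓ (U l).1 ⊓ (U m).1))
      (_ : ∀ a s, Φlm (a ⊗ₜ s) = a ⊗ₜ X.left.presheaf.map
        (homOfLE (le_inf (inf_le_left.trans inf_le_right) inf_le_right)).op s)
      (Φjm : k ⊗[k] Γ(X.left, (U j).1 ⊓ (U m).1) →ₐ[k] k ⊗[k] Γ(X.left, (U j).1 ⊓ (U l).1 ⊓ (U m).1))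
      (_ : ∀ a s, Φjm (a ⊗ₜ s) = a ⊗ₜ X.left.presheaf.map
        (homOfLE (le_inf (inf_le_left.trans inf_le_left) inf_le_right)).op s)
      (τjl : k ⊗[k] Γ(X.left, (U j).1 ⊓ (U l).1 ⊓ (U m).1) ≃ₐ[k] k ⊗[k] Γ(X.left, (U j).1 ⊓ (U l).1 ⊓ (U m).1)),
      (∀ y, τjl (Φjl ((AlgEquiv.refl : _ ≃ₐ[k] _) y)) = Φjl y) → Φjm (g j m) = Φjl (g j l) * τjl (Φlm (g l m)))
    (j l m : ι) :
    X.left.presheaf.map (homOfLE (inf_le_left : (U j).1 ⊓ (U l).1 ⊓ (U m).1 ≤ (U j).1 ⊓ (U l).1)).op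
        (Algebra.TensorProduct.lid k _ (g j l)) *
      X.left.presheaf.map (homOfLE (le_inf (inf_le_left.trans inf_le_right) inf_le_right :
        (U j).1 ⊓ (U l).1 ⊓ (U m).1 ≤ (U l).1 ⊓ (U m).1)).op (Algebra.TensorProduct.lid k _ (g l m)) =
      X.left.presheaf.map (homOfLE (le_inf (inf_le_left.trans inf_le_left) inf_le_right :
        (U j).1 ⊓ (U l).1 ⊓ (U m).1 ≤ (U j).1 ⊓ (U m).1)).op (Algebra.TensorProduct.lid k _ (g j m)) := by
  have _ := hb
  have hle : (U j).1 ⊓ (U l).1 ⊓ (U m).1 ≤ (U j).1 ⊓ (U l).1 := inf_le_left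
  obtain ⟨Φjl, hΦjl⟩ := exists_baseChangeMap (A' := k) halg ((U j).1 ⊓ (U l).1) ((U j).1 ⊓ (U l).1 ⊓ (U m).1) hle
  obtain ⟨Φlm, hΦlm⟩ := exists_baseChangeMap (A' := k) halg ((U l).1 ⊓ (U m).1) ((U j).1 ⊓ (U l).1 ⊓ (U m).1)
    (le_inf (inf_le_left.trans inf_le_right) inf_le_right)
  obtain ⟨Φjm, hΦjm⟩ := exists_baseChangeMap (A' := k) halg ((U j).1 ⊓ (U m).1) ((U j).1 ⊓ (U l).1 ⊓ (U m).1)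
    (le_inf (inf_le_left.trans inf_le_left) inf_le_right)
  have h := congrArg (Algebra.TensorProduct.lid k Γ(X.left, (U j).1 ⊓ (U l).1 ⊓ (U m).1))
    (hgcoc j l m Φjl hΦjl Φlm hΦlm Φjm hΦjm AlgEquiv.refl (fun _ => rfl))
  simp only [map_mul, AlgEquiv.coe_refl, id_eq] at h
  rw [lid_baseChangeMap halg _ hΦjm, lid_baseChangeMap halg _ hΦjl, lid_baseChangeMap halg _ hΦlm] at h
  exact h.symm

/-! ## §3 The relations `hG` and `hg` for an augmentation -/

omit instΓ in
/-- **`G - 1 ⊗ g ∈ (ker π)·(A' ⊗ Γ)` for `g := lid ((π ⊗ 1) G)`** and a `k`-algebra map `π : A' → k` onto `k` (an augmentation):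
the hypothesis `hG` of ★ `PairLiftTwistedCocycleObstruction.exists_pairObstructionCochain` with `𝔫' := ker π`.
[cite: AtiyahMacdonald1969, Prop. 2.18 and Ex. 2.2] -/
theorem sub_one_tmul_lid_mem [∀ W : X.left.Opens, Algebra k Γ(X.left, W)] (π : A' →ₐ[k] k) {W : X.left.Opens}
    (G : A' ⊗[k] Γ(X.left, W)) :
    G - (1 : A') ⊗ₜ Algebra.TensorProduct.lid k _ (Algebra.TensorProduct.map π (AlgHom.id k Γ(X.left, W)) G) ∈
      RingHom.ker π • (⊤ : Submodule A' (A' ⊗[k] Γ(X.left, W))) := by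
  have hπ : Function.Surjective π := fun s => ⟨algebraMap k A' s, π.commutes s⟩
  rw [mem_smul_top_iff_map_eq_zero π hπ, map_sub, Algebra.TensorProduct.map_tmul, map_one, AlgHom.id_apply,
    ← Algebra.TensorProduct.lid_symm_apply, AlgEquiv.symm_apply_apply, sub_self]

omit instΓ in
/-- **Units reduce to units**: `lid ((π ⊗ 1) G)` is a unit if `G` is (the hypothesis `hg`; with an inverse `gi` for P1b).
[cite: AtiyahMacdonald1969, Prop. 2.18 and Ex. 2.2] -/
theorem isUnit_lid_map [∀ W : X.left.Opens, Algebra k Γ(X.left, W)] (π : A' →ₐ[k] k) {W : X.left.Opens}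
    {G : A' ⊗[k] Γ(X.left, W)} (hG : IsUnit G) :
    IsUnit (Algebra.TensorProduct.lid k _ (Algebra.TensorProduct.map π (AlgHom.id k Γ(X.left, W)) G)) :=
  (hG.map _).map _

end Literature.AlgebraicGeometry.Deformation

end
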